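import Literature.MathematicalPhysics.QuantumFieldTheory.Balaban1983to89.Setup

/-!
# `Balaban1983to89.B15DeterminingSets` — T. Bałaban, *Large field renormalization. I. The basic step of the 𝐑
operation*, Commun. Math. Phys. **122** (1989) 175–202 [Balaban1989LargeFieldI]: the sequence of DETERMINING SETS
(1.13)–(1.17), (1.19) of the preliminary integrations and the background fields (1.18), (1.20)–(1.21), (1.26), (1.33),
(1.74), (1.77), (1.79) they define, as CONCRETE multi-scale point sets over the `Setup` tori, together with the
determining-set calculus of [Balaban1988Convergent] (= [III]) (2.2), (2.10)–(2.12), (2.14) in which they are written;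
(1.14) and (1.17) PROVED; v1.1 Part G: the nesting clause of (1.12) «{Ω″_j} is an admissible sequence» PROVED (`omegaPP_antitone`)

statement-level skeleton of published theorems with citation tags; proofs where landed; nothing here is a claim about
the Yang–Mills mass gap

PDF held: `paper:balaban1989-cmp122-large-field-i` (journal page = PDF page + 174); [III] = T. Bałaban, *Convergent
renormalization expansions for lattice gauge theories*, Commun. Math. Phys. **119** (1988) 243–285
[Balaban1988Convergent], held `paper:balaban1988-cmp119-convergent-renormalization` (journal page = PDF page + 242);
[I] = [Balaban1987RG1] (CMP **109**, journal page = PDF page + 248).  Every quotation below was READ AS AN IMAGE on the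
x2 renders `run/shared/lean/pub/pub-balaban/b2b-balaban-ref1/pages/1989-cmp122-large-field-I/…-p005,p006,p007,p008,
p010,p018,p020,p021-x2.png`, `…/1988-cmp119-convergent-renormalization/…-p013,p014,p015-x2.png`,
`…/1987-cmp109-rg-I-small-field/…-p003-x2.png`.

CITATION HEADER / WHAT IS REPRODUCED (mega-formalization `lit-balaban`, reader/typer r12 gen 2, Phase 1 continued; HOME
`run/shared/lean/pub/lit-balaban/`, rows `lit-balaban-r12/ROWS-B15.md` v3): SKELETON rows B15.Eq1.13, B15.Eq1.14–1.16,
B15.Eq1.17, B15.Eq1.18, B15.Eq1.19–1.20, B15.Eq1.21, B15.Eq1.26, B15.Eq1.33, B15.Eq1.74 (concrete companion of the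
schematic `…B16ComponentForm.blockForm`), B15.Eq1.77 (concrete companion of the abstract carrier `…B15.LFVar`),
B15.Eq1.79 — all `absent` at SKELETON v3.9 for want of "a shared multi-scale point-set model"
(`lit-balaban-r12/INTERFACES-r12.md` (a)); and, because these displays are WRITTEN IN IT, the determining-set calculus
of [III]: (2.2) `genSet`, (2.10) `AgreeOn`, (2.11) `avgFamily`, (2.12) `IsMinimizer`/`DetBackground`, (2.14) `join214`
(SKELETON rows B14.Eq2.2, B14.Eq2.10, B14.Eq2.11, B14.Eq2.12, B14.Eq2.14-2.15 read "typed-existing (abstract) · concrete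
def absent"; offered to the B14 owner r11 as concrete companions; nothing of `…Step` / `…B16Cor3Wilson` is restated).
PROVED: (1.14) (the printed three-piece rewriting of `𝔹_k` IS `𝔹_k`, `detSetN_zero`) and (1.17)
`𝔹_k^{(k−h)} = 𝔹″_k` (`detSetN_top`) as finite set algebra under the located hypotheses (admissible `{Ω_j}`
decreasing, `1 ≤ h < k`, `Z″_j ∩ Ω_j = ∅` for `h < j ≤ k` — the last from (1.10)–(1.11), `Z″_j ⊂ (Ω_j^{∼5})ᶜ`, cf.
`…B16Stage3Regions.farZ`); plus the bridge `isMinimizer_atScale_iff` to `Setup.IsBackground` and the p. 180 identity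
`Γ″_i ∩ Z = (Z″_{i+1}∖Z″_i)^{(i)} ∩ Z` (`genSetPP_inter_Z`).

READING (declared, not printed).  (a) LATTICES: the fine lattice `T_η` of step `k` is `Site P 0` and `T^{(j)}` (spacing
`L^jη`) is `Site P j` of `…Balaban1983to89.Setup` ([I] (0.1): at step `k` the `η`-lattice is the original `ε`-lattice in
rescaled units); regions `Ω_j, Z, Z″_j, Λ` are subsets of `Site P 0`; `X^{(j)}` = *"a set of lattice points, of a given
scale, belonging to it"* ([I] p. 251) is the preimage `pts j X` under the iterated centre embedding `emb` — so `(·)^{(j)}`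
commutes with `∩, ∪, ∖, ᶜ` definitionally.  (b) A determining set `{Γ_j}` is a family `DetSet P = Π j, Set (Site P j)`;
a gauge field ON a determining set ([III] (2.10)) is read as the family `Π j, GaugeField P j G` compared only on the bonds
MEETING `Γ_j` (`bondsOf`: at least one endpoint in the set — [I] p. 251 *"a set of bonds … which intersect it"*, [IV]
p. 195 *"according to our convention, bonds intersecting ∂Λ belong to 𝔹₀"*).  (c) p. 180: *"Here, and in the subsequent
formulas, the symbols Γ_j mean the intersections of these sets with the region Z"* — every member of the curly brackets of
(1.14)–(1.16) is intersected with `Z` (for the `Γ″_j` members this changes nothing in the union, see `detSetN_top`; the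
`j = k` sentence of p. 180 *"The first set in this sequence is equal to Ω^c_k ∩ Γ″_k"* requires it).  (d) The solution map
`V ↦ U(𝔹, V)` of the variational problem (2.12) (existence/uniqueness = [Balaban1985Variational] Thm 1, the quoted leaf
`…B11.Thm1Printed`) is DATA with its defining property on a domain (`DetBackground`), exactly as `Setup.Background` does
for the one-scale constraint; the localized determining sets `𝔹_k(Z)`, `𝔹_j(Ω)` of [III] (2.13)/(2.16) (maximal
admissible sequences inside a domain — cube geometry) and the configuration `Q_k^{s*}V_k` of [III] (1.3) enter as
explicit arguments.  NOT typed here: the operator identities (1.30), (1.34)–(1.36), … ("standard representation"), the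
integrals (1.25), (1.60), (1.71)–(1.72), (1.76).  Every `theorem` is finite set algebra or a definitional unfolding,
proved without `sorry` and without new axioms; nothing printed is asserted as a fact.
-/

open Set

namespace Literature.MathematicalPhysics.QuantumFieldTheory.Balaban1983to89.B15DeterminingSets

variable {P : Params}

/-! ## Part A. Multi-scale point sets: `X^{(j)}`, the `j`-lattice points of a region `X ⊂ T_η` ([I] Sect. 0) -/

/-- The inclusion `T^{(j)} ⊂ T^{(0)} = T_η` of the `j`-th lattice into the finest one, iterating the centre embedding
`emb : T^{(j+1)} → T^{(j)}` of `Setup` ([I] p. 251: *"Each lattice determines a lattice of centers of these cubes"*).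
[cite: Balaban1987RG1, (0.1) p.251] -/
def embIter : (j : ℕ) → Site P j → Site P 0
  | 0 => fun x => x
  | j + 1 => fun y => embIter j (emb y)

/-- `X^{(j)}`: [I] p. 251, verbatim: *"It is convenient to determine subsets of a lattice by subsets of continuous space.
… Such a subset determines a set of lattice points, of a given scale, belonging to it, … We denote all these sets by the
same symbol"* — the sites of `T^{(j)}` lying in the region `X ⊂ T_η` (READING (a): preimage under `embIter`). [cite: Balaban1987RG1, (0.1) p.251] -/
def pts (j : ℕ) (X : Set (Site P 0)) : Set (Site P j) := embIter j ⁻¹' X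

/-- Membership in `X^{(j)}` (definitional). [cite: Balaban1987RG1, (0.1) p.251] -/
@[simp] theorem mem_pts {j : ℕ} {X : Set (Site P 0)} {y : Site P j} : y ∈ pts j X ↔ embIter j y ∈ X := Iff.rfl

/-- At the finest scale `X^{(0)} = X`. [cite: Balaban1987RG1, (0.1) p.251] -/
theorem pts_zero (X : Set (Site P 0)) : pts 0 X = X := rfl

/-- Coarsening by one scale, the operation `(·)^{(1)}` of p. 180 (*"(Γ_h ∩ Z″ᶜ_{h+1})^{(1)}"*): `X^{(j+1)}` consists of the
points of `T^{(j+1)}` whose image in `T^{(j)}` lies in `X^{(j)}` (definitional). [cite: Balaban1989LargeFieldI, (1.15) p.180] -/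
theorem pts_succ (j : ℕ) (X : Set (Site P 0)) : pts (j + 1) X = emb ⁻¹' pts j X := rfl

/-- `(·)^{(j)}` commutes with intersections, unions, complements and differences (preimage; all definitional) — the
set algebra behind (1.13)–(1.17). [cite: Balaban1987RG1, (0.1) p.251] -/
theorem pts_boolean (j : ℕ) (X Y : Set (Site P 0)) :
    pts j (X ∩ Y) = pts j X ∩ pts j Y ∧ pts j (X ∪ Y) = pts j X ∪ pts j Y ∧
      pts j Xᶜ = (pts j X)ᶜ ∧ pts j (X \ Y) = pts j X \ pts j Y :=
  ⟨rfl, rfl, rfl, rfl⟩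

/-! ## Part B. Determining sets ([III] (2.2)), their restriction and join ((2.14)) -/

/-- A DETERMINING (generating) SET `𝔹 = {Γ_j}`: for every scale `j` a set `Γ_j` of points of `T^{(j)}` ([III] (2.2)
*"𝐁 = ∪_{j=0}^{k} Γ_j … The set 𝐁 determines the sequence {Ω_j}, and is called the determining set"*; READING (b)).
[cite: Balaban1988Convergent, (2.2) p.255] -/
abbrev DetSet (P : Params) : Type := (j : ℕ) → Set (Site P j)

namespace DetSet

/-- `𝔹 ∩ X`: the members of `𝔹` intersected scale-wise with `X^{(j)}` (the operation in *"𝔹_k ∩ (Ω_k ∪ Zᶜ)"*,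
*"𝔹_k ∩ Ω^c_h ∩ Z"* of (1.14) and *"𝐁 ∩ Ω^{∼−2}"* of [III] (2.14)). [cite: Balaban1989LargeFieldI, (1.14) p.179] -/
def restrict (𝔹 : DetSet P) (X : Set (Site P 0)) : DetSet P := fun j => 𝔹 j ∩ pts j X

/-- `𝔹 ∪ 𝔹′`: scale-wise union of two determining sets (the `∪` of (1.14)–(1.16), (1.19), [III] (2.14)). [cite: Balaban1989LargeFieldI, (1.14) p.179] -/
def union (𝔹 𝔹' : DetSet P) : DetSet P := fun j => 𝔹 j ∪ 𝔹' j

/-- Notation `𝔹 ∪ 𝔹′` for the scale-wise union. [folklore] -/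
instance : Union (DetSet P) := ⟨DetSet.union⟩

/-- Scale-wise reading of `𝔹 ∪ 𝔹′` (definitional). [cite: Balaban1989LargeFieldI, (1.14) p.179] -/
@[simp] theorem union_apply (𝔹 𝔹' : DetSet P) (j : ℕ) : (𝔹 ∪ 𝔹') j = 𝔹 j ∪ 𝔹' j := rfl

/-- Scale-wise reading of `𝔹 ∩ X` (definitional). [cite: Balaban1989LargeFieldI, (1.14) p.179] -/
@[simp] theorem restrict_apply (𝔹 : DetSet P) (X : Set (Site P 0)) (j : ℕ) :
    𝔹.restrict X j = 𝔹 j ∩ pts j X := rfl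

end DetSet

/-- The region of `T_η` whose `i`-points form the member `Γ_i` of the determining set of an admissible sequence
`{Ω_j}_{j ≤ k}` ([III] (2.2), verbatim: *"Γ₀ = Ω^c₁, Γ_j = Ω_j^{(j)}∖Ω^{(j)}_{j+1}, j = 1, …, k − 1, Γ_k = Ω_k^{(k)}"*):
`Ω₁ᶜ` at `i = 0`, `Ω_i∖Ω_{i+1}` for `1 ≤ i ≤ k − 1`, `Ω_k` at `i = k`, nothing above `k`. [cite: Balaban1988Convergent, (2.2) p.255] -/
def gammaRegion (Ω : ℕ → Set (Site P 0)) (k i : ℕ) : Set (Site P 0) :=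
  if k < i then ∅ else if i = k then Ω k else if i = 0 then (Ω 1)ᶜ else Ω i \ Ω (i + 1)

/-- **[III] (2.2)**, the determining set of `{Ω_j}`: `𝐁 = {Γ_j}_{j=0}^{k}`, `Γ_j = (gammaRegion Ω k j)^{(j)}`; this is
also **(1.13)** p. 179 applied to `{Ω″_j}` (`genSetPP`) and the `𝔹_k` of (1.14). [cite: Balaban1988Convergent, (2.2) p.255] -/
def genSet (Ω : ℕ → Set (Site P 0)) (k : ℕ) : DetSet P := fun i => pts i (gammaRegion Ω k i)

/-- **[III] (2.14)** p. 257, verbatim: *"Take the set 𝐁_j(Ω), and form a new determining set by 𝐁∪𝐁_j(Ω) = (𝐁 ∩ Ω^{∼−2})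
∪ (𝐁_j(Ω) ∩ (Ω∖Ω^{∼−2})). (2.14)"* — the join of a determining set `𝔹` with the localized one `𝔹Ω = 𝐁_j(Ω)` of the
domain `Ω`; the shrunk domain `Ω^{∼−2}` (two layers of `M₁`-cubes removed, [I] p. 257) is the explicit argument `Ωm2`
(cube geometry: `…B14DomainGeom.innerN`). [cite: Balaban1988Convergent, (2.14) p.257] -/
def join214 (𝔹 𝔹Ω : DetSet P) (Ω Ωm2 : Set (Site P 0)) : DetSet P := 𝔹.restrict Ωm2 ∪ 𝔹Ω.restrict (Ω \ Ωm2)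

section GenSetValues

variable (Ω : ℕ → Set (Site P 0)) {k i : ℕ}

/-- Above the top scale there is no member. [cite: Balaban1988Convergent, (2.2) p.255] -/
theorem gammaRegion_of_gt (h : k < i) : gammaRegion Ω k i = ∅ := by simp [gammaRegion, h]

/-- `Γ_k = Ω_k^{(k)}`. [cite: Balaban1988Convergent, (2.2) p.255] -/
theorem gammaRegion_self (k : ℕ) : gammaRegion Ω k k = Ω k := by simp [gammaRegion]

/-- `Γ₀ = Ω₁ᶜ` (for `k ≥ 1`). [cite: Balaban1988Convergent, (2.2) p.255] -/
theorem gammaRegion_zero (hk : 0 < k) : gammaRegion Ω k 0 = (Ω 1)ᶜ := by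
  have h1 : (0 : ℕ) ≠ k := by omega
  simp [gammaRegion, h1]

/-- `Γ_i = Ω_i^{(i)}∖Ω^{(i)}_{i+1}` for `1 ≤ i ≤ k − 1`. [cite: Balaban1988Convergent, (2.2) p.255] -/
theorem gammaRegion_mid (h0 : 0 < i) (hk : i < k) : gammaRegion Ω k i = Ω i \ Ω (i + 1) := by
  have h1 : ¬ k < i := by omega
  have h2 : i ≠ k := by omega
  have h3 : i ≠ 0 := by omega
  simp [gammaRegion, h1, h2, h3]

end GenSetValues

/-! ## Part C. [III] (2.10)–(2.12): the field on a determining set, the averaging `M_𝐁`, the variational problem -/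

section Fields

variable {G : Type*}

/-- A multi-scale gauge field `{V_j}`, `V_j` on `T^{(j)}` ([III] p. 256: *"gauge field variables V_{j−1} are defined on
bonds of Ω_j^{(j−1)c}"*); only its values on (the bonds of) a determining set matter below. [cite: Balaban1988Convergent, (2.10) p.256] -/
abbrev MSField (P : Params) (G : Type*) : Type _ := (j : ℕ) → GaugeField P j G

/-- The bonds of `T^{(j)}` MEETING a point set `S ⊂ T^{(j)}` (READING (b) of [I] p. 251 *"a set of bonds, i.e. intervals
b connecting nearest neighbor points b₋, b₊, which intersect it"*): at least one endpoint in `S`. [cite: Balaban1987RG1, (0.1) p.251] -/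
def bondsOf {j : ℕ} (S : Set (Site P j)) : Set (PBond P j) := {b | b.src ∈ S ∨ b.tgt ∈ S}

/-- **[III] (2.10)** p. 256, verbatim: *"The fields V_j determine the field V defined on 𝐁: V = V_j on Γ_j, j = 0, 1, …,
k. (2.10)"* ([IV] p. 180: *"the collection of the restrictions of these fields defines a gauge field on the determining
set … they are defined by the same equality in (2.10) [III]"*) — two multi-scale fields define the same field on `𝔹`
iff they agree on every bond meeting every `Γ_j`. [cite: Balaban1988Convergent, (2.10) p.256] -/
def AgreeOn (𝔹 : DetSet P) (V W : MSField P G) : Prop := ∀ j, ∀ b ∈ bondsOf (𝔹 j), V j b = W j b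

/-- The one-scale determining set "everything at scale `k`" (`Γ_k = T^{(k)}`, no other member): the constraint of
[I] (0.21) / `Setup.IsBackground`, `M^k(U) = V`. [cite: Balaban1987RG1, (0.21) p.256] -/
def atScale (k : ℕ) : DetSet P := fun j => if j = k then Set.univ else ∅

/-- On the one-scale determining set, agreement on `𝔹` is equality of the scale-`k` fields. [cite: Balaban1988Convergent, (2.10) p.256] -/
theorem agreeOn_atScale_iff (k : ℕ) (V W : MSField P G) : AgreeOn (atScale k) V W ↔ V k = W k := by
  constructor
  · intro hVW
    funext b
    exact hVW k b (by simp [atScale, bondsOf])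
  · intro hk j b hb
    by_cases hj : j = k
    · subst j
      rw [hk]
    · simp [atScale, hj, bondsOf] at hb

open Classical in
/-- Splicing two configurations of one scale along a point set `S`: the first on the bonds meeting `S`, the second
elsewhere (the restrictions `(W↾_X, V↾_{Xᶜ})` of (1.20), (1.33)). [cite: Balaban1989LargeFieldI, (1.20) p.180] -/
noncomputable def spliceAt {j : ℕ} (S : Set (Site P j)) (W V : GaugeField P j G) : GaugeField P j G :=
  fun b => if b ∈ bondsOf S then W b else V b

/-- Multi-scale splice along a region `X ⊂ T_η`: scale by scale along `X^{(j)}`. [cite: Balaban1989LargeFieldI, (1.20) p.180] -/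
noncomputable def splice (X : Set (Site P 0)) (W V : MSField P G) : MSField P G :=
  fun j => spliceAt (pts j X) (W j) (V j)

variable [GaugeGroup G]

/-- **[III] (2.11)** p. 256, verbatim: *"It is convenient also to introduce the averaging operation M_𝐁 associated with a
determining set 𝐁. It transforms a gauge field U on the lattice T_η into the gauge field M_𝐁(U) defined on the set 𝐁 by
the equalities M_𝐁(U) = M^j(U) on Γ_j, j = 0, 1, …, k. (2.11)"* — as a multi-scale field it is `j ↦ M^j(U)`
(`Setup.Averaging.iter`), to be compared on `𝔹` only (`AgreeOn 𝔹`); this is also the `M˙(·)` of (1.20), (1.33), (1.74). [cite: Balaban1988Convergent, (2.11) p.256] -/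
def avgFamily (av : ∀ j, Averaging P j G) (U : GaugeField P 0 G) : MSField P G := fun j => Averaging.iter av j U

/-- **[III] (2.12)** p. 256, verbatim: *"A regular configuration V on 𝐁 determines the minimal orbit, i.e., the set of
minima, of the functional U → A^η(U) on U : U regular and M_𝐁(U) = V. (2.12) … A minimal configuration, i.e., an
element of the unique minimal orbit, is denoted by U_𝐁(V), or U_k(V), or simply U_k"* — `U₀` is a minimal configuration:
it lies in the regular class `reg`, satisfies the constraint on `𝔹`, and minimizes the (`d = 4`) Wilson action
`Setup.wilsonAction4` among such `U`.  Existence/uniqueness is [Balaban1985Variational] Thm 1 (`…B11.Thm1Printed`), NOT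
asserted. [cite: Balaban1988Convergent, (2.12) p.256] -/
def IsMinimizer (av : ∀ j, Averaging P j G) (reg : Set (GaugeField P 0 G)) (𝔹 : DetSet P) (V : MSField P G)
    (U₀ : GaugeField P 0 G) : Prop :=
  U₀ ∈ reg ∧ AgreeOn 𝔹 (avgFamily av U₀) V ∧
    ∀ U : GaugeField P 0 G, U ∈ reg → AgreeOn 𝔹 (avgFamily av U) V → wilsonAction4 U₀ ≤ wilsonAction4 U

/-- The solution map `(𝐁, V) ↦ U(𝐁, V) = U_𝐁(V)` of (2.12) as DATA with its defining property on a domain `dom 𝐁` of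
regular `V` ([III] (2.13) *"U(𝐁_j(Ω), ·) = U_{j,Ω}(·)"*, (2.15) *"U(𝐁∪𝐁_j(Ω), ·) = U_{𝐁,Ω}(·)"*) — the multi-scale
generalisation of `Setup.Background` (one constraint scale), see `isMinimizer_atScale_iff`. [cite: Balaban1988Convergent, (2.12)–(2.13) p.256–257] -/
structure DetBackground (P : Params) (G : Type*) [GaugeGroup G] (av : ∀ j, Averaging P j G) where
  reg : Set (GaugeField P 0 G)
  dom : DetSet P → Set (MSField P G)
  U : DetSet P → MSField P G → GaugeField P 0 G
  isMinimizer : ∀ 𝔹 V, V ∈ dom 𝔹 → IsMinimizer av reg 𝔹 V (U 𝔹 V)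

/-- BRIDGE: a minimal configuration for the one-scale determining set `atScale k` and data `V` is exactly a background
field of `Setup` for the constraint `M^k(U) = V_k` (`Setup.IsBackground`), over the same regular class. [cite: Balaban1988Convergent, (2.12) p.256] -/
theorem isMinimizer_atScale_iff (av : ∀ j, Averaging P j G) (reg : Set (GaugeField P 0 G)) (k : ℕ) (V : MSField P G)
    (U₀ : GaugeField P 0 G) : IsMinimizer av reg (atScale k) V U₀ ↔ IsBackground av reg k (V k) U₀ := by
  simp only [IsMinimizer, IsBackground, avgFamily, agreeOn_atScale_iff]
  constructor
  · rintro ⟨hreg, hc, hmin⟩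
    exact ⟨hc, hreg, fun U hU hUV => hmin U hU hUV⟩
  · rintro ⟨hc, hreg, hmin⟩
    exact ⟨hreg, hc, fun U hU hUV => hmin U hU hUV⟩

end Fields

/-! ## Part D. B15 (1.12)–(1.17): the new domains `Ω″_j`, the generating set `𝔹″_k`, the sequence `𝔹_k^{(n)}` -/

section NewDomains

variable (Ω Zpp : ℕ → Set (Site P 0)) (Z : Set (Site P 0)) (h k : ℕ)

/-- **(1.12)** p. 179 [PDF 5], verbatim: *"We define new domains Ω″_j by Ω″_j = (Z″ᶜ_j ∩ Z) ∪ (Ω_j ∩ Zᶜ) for j = k,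
k − 1, …, h + 1, Ω″_j = Ω_j for j = h, h − 1, …, 1. (1.12) The sequence {Ω″_j} is an admissible sequence"* (`Zpp j` =
`Z″_j` of (1.10)–(1.11); the same display on `ℤᵈ` with cube geometry is `…B16Stage3Regions.OmegaPP`; admissibility is
not typed). [cite: Balaban1989LargeFieldI, (1.12) p.179] -/
def omegaPP : ℕ → Set (Site P 0) := fun j => if h < j then ((Zpp j)ᶜ ∩ Z) ∪ (Ω j ∩ Zᶜ) else Ω j

/-- **(1.13)** p. 179, verbatim: *"the corresponding generating set is denoted by 𝔹″_k. Thus 𝔹″_k = {Γ″_j}, Γ″_j =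
(Ω″_j∖Ω″_{j+1})^{(j)}, j = k − 1, …, 1, Γ″_k = (Ω″_k)^{(k)}, Γ″₀ = Ω″ᶜ₁. (1.13)"* — the determining set ([III] (2.2)) of
the sequence `{Ω″_j}` of (1.12). [cite: Balaban1989LargeFieldI, (1.13) p.179] -/
def genSetPP : DetSet P := genSet (omegaPP Ω Zpp Z h) k

variable {Ω Zpp Z h}

/-- `Ω″_j = Ω_j` for `j ≤ h`. [cite: Balaban1989LargeFieldI, (1.12) p.179] -/
theorem omegaPP_of_le {j : ℕ} (hj : j ≤ h) : omegaPP Ω Zpp Z h j = Ω j := by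
  have : ¬ h < j := by omega
  simp [omegaPP, this]

/-- `Ω″_j = (Z″ᶜ_j ∩ Z) ∪ (Ω_j ∩ Zᶜ)` for `j > h`. [cite: Balaban1989LargeFieldI, (1.12) p.179] -/
theorem omegaPP_of_lt {j : ℕ} (hj : h < j) : omegaPP Ω Zpp Z h j = ((Zpp j)ᶜ ∩ Z) ∪ (Ω j ∩ Zᶜ) := by
  simp [omegaPP, hj]

variable (Ω Zpp Z h)

/-- The members of the curly bracket of **(1.14)** (`n = 0`) as regions of `T_η`, scale by scale, with READING (c)
(*"the symbols Γ_j mean the intersections of these sets with the region Z"*): `{Γ_{k−1}, …, Γ_{h+1}, Γ_h}`, i.e.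
`Γ_i ∩ Z` for `h ≤ i ≤ k − 1`, nothing at other scales. [cite: Balaban1989LargeFieldI, (1.14) p.179] -/
def mid0Region (i : ℕ) : Set (Site P 0) := if h ≤ i ∧ i < k then gammaRegion Ω k i ∩ Z else ∅

/-- The members of the curly bracket of **(1.15)/(1.16)** for `j = h + n`, `1 ≤ n` (p. 180 [PDF 6], verbatim (1.16):
*"{Γ_{k−1}, …, Γ_{j+1}, (Ω^c_{j+1}∖Z″_j)^{(j)}, Γ″_{j−1}, …, Γ″_{h+1}, Γ_h ∩ Z″_{h+1}}"*, and *"For j = k we replace the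
sequence in the curly bracket above by (Ω^c_k∖Z″_k)^{(k)}, Γ″_{k−1}, …, Γ″_{h+1}, Γ_h ∩ Z″_{h+1}"*), as regions of `T_η`
scale by scale, every member intersected with `Z` (READING (c)): at scale `h` the member `Γ_h ∩ Z″_{h+1}`; at scales
`h < i < j` the members `Γ″_i`; at scale `j` the member `(Ω^c_{j+1}∖Z″_j)^{(j)}` (`j < k`) resp. `(Ω^c_k∖Z″_k)^{(k)}`
(`j ≥ k`); at scales `j < i < k` the members `Γ_i`. [cite: Balaban1989LargeFieldI, (1.16) p.180] -/
def curlyRegion (j i : ℕ) : Set (Site P 0) :=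
  (if i = h then gammaRegion Ω k i ∩ (Z ∩ Zpp (i + 1)) else ∅) ∪
  (if h < i ∧ i < j then gammaRegion (omegaPP Ω Zpp Z h) k i ∩ Z else ∅) ∪
  (if i = j ∧ j < k then ((Ω (i + 1))ᶜ \ Zpp i) ∩ Z else ∅) ∪
  (if i = j ∧ k ≤ j then ((Ω i)ᶜ \ Zpp i) ∩ Z else ∅) ∪
  (if j < i ∧ i < k then gammaRegion Ω k i ∩ Z else ∅)

/-- The curly bracket of `𝔹_k^{(n)}`: (1.14) for `n = 0`, (1.15)/(1.16) (with its `j = k` variant) for `j = h + n`,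
`n ≥ 1`. [cite: Balaban1989LargeFieldI, (1.16) p.180] -/
def midRegion : ℕ → ℕ → Set (Site P 0)
  | 0, i => mid0Region Ω Z h k i
  | n + 1, i => curlyRegion Ω Zpp Z h k (h + (n + 1)) i

/-- **(1.14)–(1.16)** pp. 179–180, the determining set after `n` preliminary integrations, verbatim (1.14): *"𝔹_k^{(0)} = 𝔹_k
= (𝔹_k ∩ (Ω_k ∪ Zᶜ)) ∪ {Γ_{k−1}, …, Γ_{h+1}, Γ_h} ∪ (𝔹_k ∩ Ω^c_h ∩ Z)"*, (1.15): *"𝔹_k^{(1)} = (𝔹_k ∩ (Ω_k ∪ Zᶜ)) ∪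
{Γ_{k−1}, …, Γ_{h+2}, (Ω^c_{h+2}∖Z″_{h+1})^{(h+1)}, Γ_h ∩ Z″_{h+1}} ∪ (𝔹_k ∩ Ω^c_h ∩ Z)"*, (1.16): *"In general, the set
𝔹_k^{(j−h)} is defined by 𝔹_k^{(j−h)} = (𝔹_k ∩ (Ω_k ∪ Zᶜ)) ∪ {…} ∪ (𝔹_k ∩ Ω^c_h ∩ Z), (1.16) for j = h + 1, …, k − 1"*
(+ the `j = k` variant quoted at `curlyRegion`).  `𝔹_k` = `genSet Ω k` ([III] (2.2) for the admissible sequence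
`{Ω_j}_{j ≤ k}` of the `k`-th density); typed as `(region)^{(i)}` scale by scale, and equal to the printed three-piece
union by `detSetN_eq_union`. [cite: Balaban1989LargeFieldI, (1.14)–(1.16) pp.179–180] -/
def detSetN (n : ℕ) : DetSet P := fun i =>
  pts i ((gammaRegion Ω k i ∩ (Ω k ∪ Zᶜ)) ∪ midRegion Ω Zpp Z h k n i ∪ (gammaRegion Ω k i ∩ ((Ω h)ᶜ ∩ Z)))

/-- (1.14)–(1.16) in the printed three-piece form `(𝔹_k ∩ (Ω_k ∪ Zᶜ)) ∪ {…} ∪ (𝔹_k ∩ Ω^c_h ∩ Z)` (definitional).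
[cite: Balaban1989LargeFieldI, (1.16) p.180] -/
theorem detSetN_eq_union (n : ℕ) :
    detSetN Ω Zpp Z h k n =
      (genSet Ω k).restrict (Ω k ∪ Zᶜ) ∪ (fun i => pts i (midRegion Ω Zpp Z h k n i)) ∪
        (genSet Ω k).restrict ((Ω h)ᶜ ∩ Z) := rfl

/-- **(1.21)** p. 181 [PDF 7] (with (1.17)): the last set of the sequence, `𝔹_k^{(N)}`, `N = k − h` (*"U_k^{(N)} = U″_k,
U^{(N)}_{k,Z} = U″_{k,Z}. (1.21)"*). [cite: Balaban1989LargeFieldI, (1.21) p.181] -/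
def detSetTop : DetSet P := detSetN Ω Zpp Z h k (k - h)

variable {Ω Zpp Z h k}

/-! ### The members of the `j = k` bracket, scale by scale (p. 180) -/

/-- In the `j = k` bracket there is no member above scale `k`. [cite: Balaban1989LargeFieldI, (1.16) p.180] -/
theorem curlyRegion_top_of_gt {i : ℕ} (hhk : h ≤ k) (hki : k < i) : curlyRegion Ω Zpp Z h k k i = ∅ := by
  have h1 : ¬ i = h := by omega
  have h2 : ¬ (h < i ∧ i < k) := by omega
  have h3 : ¬ (i = k ∧ k < k) := by omega
  have h4 : ¬ (i = k ∧ k ≤ k) := by omega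
  have h5 : ¬ (k < i ∧ i < k) := by omega
  unfold curlyRegion
  rw [if_neg h1, if_neg h2, if_neg h3, if_neg h4, if_neg h5]
  simp only [Set.union_empty]

/-- In the `j = k` bracket there is no member below scale `h`. [cite: Balaban1989LargeFieldI, (1.16) p.180] -/
theorem curlyRegion_top_of_lt {i : ℕ} (hih : i < h) (hhk : h ≤ k) : curlyRegion Ω Zpp Z h k k i = ∅ := by
  have h1 : ¬ i = h := by omega
  have h2 : ¬ (h < i ∧ i < k) := by omega
  have h3 : ¬ (i = k ∧ k < k) := by omega
  have h4 : ¬ (i = k ∧ k ≤ k) := by omega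
  have h5 : ¬ (k < i ∧ i < k) := by omega
  unfold curlyRegion
  rw [if_neg h1, if_neg h2, if_neg h3, if_neg h4, if_neg h5]
  simp only [Set.union_empty]

/-- The scale-`h` member of the `j = k` bracket: `Γ_h ∩ Z″_{h+1}` (∩ `Z`). [cite: Balaban1989LargeFieldI, (1.16) p.180] -/
theorem curlyRegion_top_h (hhk : h < k) : curlyRegion Ω Zpp Z h k k h = gammaRegion Ω k h ∩ (Z ∩ Zpp (h + 1)) := by
  have h2 : ¬ (h < h ∧ h < k) := by omega
  have h3 : ¬ (h = k ∧ k < k) := by omega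
  have h4 : ¬ (h = k ∧ k ≤ k) := by omega
  have h5 : ¬ (k < h ∧ h < k) := by omega
  unfold curlyRegion
  rw [if_pos rfl, if_neg h2, if_neg h3, if_neg h4, if_neg h5]
  simp only [Set.union_empty]

/-- The scale-`i` members of the `j = k` bracket for `h < i < k`: `Γ″_i` (∩ `Z`). [cite: Balaban1989LargeFieldI, (1.16) p.180] -/
theorem curlyRegion_top_mid {i : ℕ} (hhi : h < i) (hik : i < k) :
    curlyRegion Ω Zpp Z h k k i = gammaRegion (omegaPP Ω Zpp Z h) k i ∩ Z := by
  have h1 : ¬ i = h := by omega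
  have h3 : ¬ (i = k ∧ k < k) := by omega
  have h4 : ¬ (i = k ∧ k ≤ k) := by omega
  have h5 : ¬ (k < i ∧ i < k) := by omega
  unfold curlyRegion
  rw [if_neg h1, if_pos ⟨hhi, hik⟩, if_neg h3, if_neg h4, if_neg h5]
  simp only [Set.union_empty, Set.empty_union]

/-- The scale-`k` member of the `j = k` bracket: `(Ω^c_k∖Z″_k)^{(k)}` (∩ `Z`). [cite: Balaban1989LargeFieldI, (1.16) p.180] -/
theorem curlyRegion_top_self (hhk : h < k) : curlyRegion Ω Zpp Z h k k k = ((Ω k)ᶜ \ Zpp k) ∩ Z := by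
  have h1 : ¬ k = h := by omega
  have h2 : ¬ (h < k ∧ k < k) := by omega
  have h3 : ¬ (k = k ∧ k < k) := by omega
  have h4 : (k = k ∧ k ≤ k) := ⟨rfl, le_rfl⟩
  have h5 : ¬ (k < k ∧ k < k) := by omega
  unfold curlyRegion
  rw [if_neg h1, if_neg h2, if_neg h3, if_pos h4, if_neg h5]
  simp only [Set.union_empty, Set.empty_union]

/-- **(1.14) holds**: the three-piece rewriting `(𝔹_k ∩ (Ω_k ∪ Zᶜ)) ∪ {Γ_{k−1}, …, Γ_h} ∪ (𝔹_k ∩ Ω^c_h ∩ Z)` of the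
determining set `𝔹_k` IS `𝔹_k`, for any decreasing sequence `Ω_0 ⊇ Ω_1 ⊇ ⋯` and any `h`, `Z` — PROVED (finite set
algebra). [cite: Balaban1989LargeFieldI, (1.14) p.179] -/
theorem detSetN_zero (hΩ : ∀ ⦃a b : ℕ⦄, a ≤ b → Ω b ⊆ Ω a) : detSetN Ω Zpp Z h k 0 = genSet Ω k := by
  funext i
  simp only [detSetN, genSet, midRegion]
  congr 1
  ext x
  rcases Nat.lt_or_ge k i with hki | hik
  · have hmid : ¬ (h ≤ i ∧ i < k) := by omega
    simp [mid0Region, hmid, gammaRegion_of_gt Ω hki]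
  rcases Nat.eq_or_lt_of_le hik with hik_eq | hik'
  · subst i
    have hmid : ¬ (h ≤ k ∧ k < k) := by omega
    simp only [mid0Region, gammaRegion_self, mem_union, mem_inter_iff, mem_compl_iff, mem_ite_empty_right]
    tauto
  rcases Nat.eq_zero_or_pos i with hi0 | hi0
  · subst i
    have hk1 : x ∈ Ω k → x ∈ Ω 1 := fun hx => hΩ (show 1 ≤ k by omega) hx
    simp only [mid0Region, gammaRegion_zero Ω hik', mem_union, mem_inter_iff, mem_compl_iff, mem_ite_empty_right]
    rcases Nat.eq_zero_or_pos h with hh0 | hh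
    · have hle : h ≤ 0 := hh0.le
      tauto
    · have hle : ¬ h ≤ 0 := by omega
      have hh1 : x ∈ Ω h → x ∈ Ω 1 := fun hx => hΩ (show 1 ≤ h by omega) hx
      tauto
  · have hk1 : x ∈ Ω k → x ∈ Ω (i + 1) := fun hx => hΩ (show i + 1 ≤ k by omega) hx
    simp only [mid0Region, gammaRegion_mid Ω hi0 hik', mem_union, mem_inter_iff, mem_sdiff, mem_compl_iff,
      mem_ite_empty_right]
    rcases Nat.lt_or_ge i h with hih | hhi
    · have hle : ¬ h ≤ i := by omega
      have hh1 : x ∈ Ω h → x ∈ Ω (i + 1) := fun hx => hΩ (show i + 1 ≤ h by omega) hx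
      tauto
    · have hle : h ≤ i := hhi
      tauto

/-- p. 180, verbatim: *"(Z″_{h+2}∖Z″_{h+1})^{(h+1)} = Γ″_{h+1}"*; in general for `h < i < k`: the member `Γ″_i` of `𝔹″_k`,
intersected with `Z` (READING (c)), is `(Z″_{i+1}∖Z″_i)^{(i)} ∩ Z` — PROVED from (1.12) alone. [cite: Balaban1989LargeFieldI, (1.15) p.180] -/
theorem genSetPP_inter_Z {i : ℕ} (hhi : h < i) (hik : i < k) :
    genSetPP Ω Zpp Z h k i ∩ pts i Z = pts i ((Zpp (i + 1) \ Zpp i) ∩ Z) := by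
  simp only [genSetPP, genSet]
  ext y
  simp only [mem_inter_iff, mem_pts, gammaRegion_mid (omegaPP Ω Zpp Z h) (show 0 < i by omega) hik,
    omegaPP_of_lt hhi, omegaPP_of_lt (show h < i + 1 by omega), mem_sdiff, mem_union, mem_compl_iff]
  tauto

/-- **(1.17) holds**, p. 180, verbatim: *"The first set in this sequence is equal to Ω^c_k ∩ Γ″_k, and we combine it with
the set Γ_k in 𝔹_k ∩ (Ω_k ∪ Zᶜ). The union is equal to Γ″_k, hence 𝔹_k^{(k−h)} = 𝔹_k^{(N)} = 𝔹″_k. (1.17)"* — PROVED as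
finite set algebra for a decreasing sequence `{Ω_j}`, `1 ≤ h < k`, and new large-field regions `Z″_j` disjoint from
`Ω_j` for `h < j ≤ k` (from (1.10)–(1.11): `Z″_j ⊂ (Ω_j^{∼5})ᶜ`; cf. `…B16Stage3Regions.farZ`).  (Whether the `Γ″`
members of the curly bracket are intersected with `Z` or not does not change the union.) [cite: Balaban1989LargeFieldI, (1.17) p.180] -/
theorem detSetN_top (hΩ : ∀ ⦃a b : ℕ⦄, a ≤ b → Ω b ⊆ Ω a) (hh : 0 < h) (hhk : h < k)
    (hdisj : ∀ j, h < j → j ≤ k → Disjoint (Zpp j) (Ω j)) :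
    detSetN Ω Zpp Z h k (k - h) = genSetPP Ω Zpp Z h k := by
  obtain ⟨N, hN⟩ : ∃ N, k - h = N + 1 := ⟨k - h - 1, by omega⟩
  have hj : h + (N + 1) = k := by omega
  rw [hN]
  funext i
  simp only [detSetN, genSetPP, genSet, midRegion, hj]
  congr 1
  ext x
  rcases Nat.lt_or_ge k i with hki | hik
  · -- scales above `k`: nothing on either side
    rw [curlyRegion_top_of_gt hhk.le hki, gammaRegion_of_gt Ω hki, gammaRegion_of_gt (omegaPP Ω Zpp Z h) hki]
    simp
  rcases Nat.eq_or_lt_of_le hik with hik_eq | hik'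
  · -- scale `k`: `Γ_k ∪ ((Ω^c_k∖Z″_k)^{(k)} ∩ Z) = Γ″_k`
    subst i
    have hZΩ : x ∈ Zpp k → x ∉ Ω k := fun hz hx => Set.disjoint_left.mp (hdisj k hhk le_rfl) hz hx
    have hkh : x ∈ Ω k → x ∈ Ω h := fun hx => hΩ hhk.le hx
    rw [curlyRegion_top_self hhk, gammaRegion_self Ω k, gammaRegion_self (omegaPP Ω Zpp Z h) k, omegaPP_of_lt hhk]
    clear hdisj hΩ
    simp only [mem_union, mem_inter_iff, mem_sdiff, mem_compl_iff]
    tauto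
  rcases Nat.lt_trichotomy i h with hih | hih_eq | hhi
  · -- scales below `h`: `Γ″_i = Γ_i`
    rw [curlyRegion_top_of_lt hih hhk.le]
    rcases Nat.eq_zero_or_pos i with hi0 | hi0
    · subst i
      have hk1 : x ∈ Ω k → x ∈ Ω 1 := fun hx => hΩ (show 1 ≤ k by omega) hx
      have hh1 : x ∈ Ω h → x ∈ Ω 1 := fun hx => hΩ (show 1 ≤ h by omega) hx
      rw [gammaRegion_zero Ω hik', gammaRegion_zero (omegaPP Ω Zpp Z h) hik', omegaPP_of_le (show 1 ≤ h by omega)]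
      clear hdisj hΩ
      simp only [mem_union, mem_inter_iff, mem_compl_iff, mem_empty_iff_false]
      tauto
    · have hk1 : x ∈ Ω k → x ∈ Ω (i + 1) := fun hx => hΩ (show i + 1 ≤ k by omega) hx
      have hh1 : x ∈ Ω h → x ∈ Ω (i + 1) := fun hx => hΩ (show i + 1 ≤ h by omega) hx
      rw [gammaRegion_mid Ω hi0 hik', gammaRegion_mid (omegaPP Ω Zpp Z h) hi0 hik', omegaPP_of_le hih.le,
        omegaPP_of_le (show i + 1 ≤ h by omega)]
      clear hdisj hΩ
      simp only [mem_union, mem_inter_iff, mem_compl_iff, mem_sdiff, mem_empty_iff_false]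
      tauto
  · -- scale `h`: `(Γ_h ∩ Zᶜ) ∪ (Γ_h ∩ Z″_{h+1}) = Γ″_h`
    subst i
    have hk1 : x ∈ Ω k → x ∈ Ω (h + 1) := fun hx => hΩ (show h + 1 ≤ k by omega) hx
    have hZΩ : x ∈ Zpp (h + 1) → x ∉ Ω (h + 1) := fun hz hx =>
      Set.disjoint_left.mp (hdisj (h + 1) (by omega) (by omega)) hz hx
    rw [curlyRegion_top_h hhk, gammaRegion_mid Ω hh hhk, gammaRegion_mid (omegaPP Ω Zpp Z h) hh hhk,
      omegaPP_of_le (le_refl h), omegaPP_of_lt (show h < h + 1 by omega)]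
    clear hdisj hΩ
    simp only [mem_union, mem_inter_iff, mem_compl_iff, mem_sdiff]
    tauto
  · -- scales `h < i < k`: `(Γ_i ∩ Zᶜ) ∪ (Γ″_i ∩ Z) = Γ″_i`
    have hk1 : x ∈ Ω k → x ∈ Ω (i + 1) := fun hx => hΩ (show i + 1 ≤ k by omega) hx
    have hih : x ∈ Ω i → x ∈ Ω h := fun hx => hΩ hhi.le hx
    rw [curlyRegion_top_mid hhi hik', gammaRegion_mid Ω (show 0 < i by omega) hik',
      gammaRegion_mid (omegaPP Ω Zpp Z h) (show 0 < i by omega) hik', omegaPP_of_lt hhi,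
      omegaPP_of_lt (show h < i + 1 by omega)]
    clear hdisj hΩ
    simp only [mem_union, mem_inter_iff, mem_compl_iff, mem_sdiff]
    constructor
    · rintro ((⟨⟨hxi, hxi1⟩, hkz⟩ | ⟨hC, _⟩) | ⟨⟨hxi, _⟩, hxh, _⟩)
      · have hz : x ∉ Z := fun hz => hkz.elim (fun hxk => hxi1 (hk1 hxk)) fun hnz => hnz hz
        exact ⟨Or.inr ⟨hxi, hz⟩, fun hc => hc.elim (fun h' => hz h'.2) fun h' => hxi1 h'.1⟩
      · exact hC
      · exact absurd (hih hxi) hxh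
    · intro hC
      by_cases hz : x ∈ Z
      · exact Or.inl (Or.inr ⟨hC, hz⟩)
      · obtain ⟨hC1, hC2⟩ := hC
        rcases hC1 with ⟨_, hz'⟩ | ⟨hxi, _⟩
        · exact absurd hz' hz
        · exact Or.inl (Or.inl ⟨⟨hxi, fun hxi1 => hC2 (Or.inr ⟨hxi1, hz⟩)⟩, Or.inr hz⟩)

end NewDomains

/-! ## Part E. The background fields (1.18)–(1.21), (1.26), (1.33), (1.74), (1.77), (1.79) -/

section Backgrounds

variable {G : Type*} [GaugeGroup G] {av : ∀ j, Averaging P j G} (bg : DetBackground P G av)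
variable (Ω Zpp : ℕ → Set (Site P 0)) (Z : Set (Site P 0)) (h k : ℕ)

/-- **(1.18)** p. 180 [PDF 6], verbatim: *"The determining set 𝔹_k^{(n)} and the gauge field V define the function U_k^{(n)} =
U_k^{(n)}(V) = U(𝔹_k^{(n)}, V). (1.18) These configurations are background fields in the successive integrations."*
[cite: Balaban1989LargeFieldI, (1.18) p.180] -/
def bgN (n : ℕ) (V : MSField P G) : GaugeField P 0 G := bg.U (detSetN Ω Zpp Z h k n) V

/-- **(1.19)** p. 180, verbatim: *"The determining sets 𝔹_k^{(n)}(Z) are defined as above, by the equalities (1.14)–(1.17),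
but the set 𝔹_k ∩ (Ω_k ∪ Zᶜ) is replaced by 𝔹_k(Z) ∩ Ω_k. Thus, according to the definition (2.14) [III], they may be
defined as 𝔹_k^{(n)}(Z) = 𝔹_k^{(n)} ∪ 𝔹_k(Z). (1.19)"* — typed by the first sentence; `BkZ` = the localized
determining set `𝔹_k(Z)` of [III] (2.13)/(2.16) for the domain `Z` (READING (d): an explicit argument). [cite: Balaban1989LargeFieldI, (1.19) p.180] -/
def detSetNZ (n : ℕ) (BkZ : DetSet P) : DetSet P :=
  BkZ.restrict (Ω k) ∪ fun i => pts i (midRegion Ω Zpp Z h k n i ∪ (gammaRegion Ω k i ∩ ((Ω h)ᶜ ∩ Z)))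

/-- **(1.20)** p. 180, verbatim: *"The corresponding functions are defined by the gauge fields V restricted to Ω^c_k, and
by M_{𝔹_k(Z)}(Q_k^{s*}V_k) restricted to Z ∩ Ω_k, thus U^{(n)}_{k,Z} = U^{(n)}_{k,Z}(V) = U(𝔹_k^{(n)}(Z), (M˙(Q_k^{s*}V_k)
↾_{Z∩Ω_k}, V↾_{Z∩Ω^c_k})). (1.20)"* — `Qs` = the map `V_k ↦ Q_k^{s*}V_k` of [III] (1.3) (with `k`-blocks, [III] p. 257),
an explicit argument; `M˙(·)` = `avgFamily`. [cite: Balaban1989LargeFieldI, (1.20) p.180] -/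
noncomputable def bgNZ (n : ℕ) (BkZ : DetSet P) (Qs : GaugeField P k G → GaugeField P 0 G) (V : MSField P G) :
    GaugeField P 0 G :=
  bg.U (detSetNZ Ω Zpp Z h k n BkZ) (splice (Z ∩ Ω k) (avgFamily av (Qs (V k))) V)

/-- **(1.21)** p. 181 [PDF 7], verbatim: *"For the last functions in the sequences (1.18)–(1.20) we introduce the following
notations U_k^{(N)} = U″_k, U^{(N)}_{k,Z} = U″_{k,Z}. (1.21)"* (`N = k − h`): `U″_k`. [cite: Balaban1989LargeFieldI, (1.21) p.181] -/
def bgPP (V : MSField P G) : GaugeField P 0 G := bgN bg Ω Zpp Z h k (k - h) V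

/-- (1.21), second member: `U″_{k,Z} = U^{(N)}_{k,Z}`. [cite: Balaban1989LargeFieldI, (1.21) p.181] -/
noncomputable def bgPPZ (BkZ : DetSet P) (Qs : GaugeField P k G → GaugeField P 0 G) (V : MSField P G) :
    GaugeField P 0 G :=
  bgNZ bg Ω Zpp Z h k (k - h) BkZ Qs V

/-- **(1.26)** p. 182 [PDF 8], verbatim: *"Next, we introduce restrictions on an approximate fluctuation field. Define the
configuration V_Z^{(j)} = M^j(U^{(j+1−h)}_{k,Z}), (1.26)"* — the `j`-th average (`Setup.Averaging.iter`) of the localized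
background after `n + 1 = j + 1 − h` integrations. [cite: Balaban1989LargeFieldI, (1.26) p.182] -/
noncomputable def vZ (BkZ : DetSet P) (Qs : GaugeField P k G → GaugeField P 0 G) (V : MSField P G) (j : ℕ) :
    GaugeField P j G :=
  Averaging.iter av j (bgNZ bg Ω Zpp Z h k (j + 1 - h) BkZ Qs V)

end Backgrounds

section LocalBackgrounds

variable {G : Type*} [GaugeGroup G] {av : ∀ j, Averaging P j G} (bg : DetBackground P G av) {k : ℕ}

/-- **(1.33)** p. 184 [PDF 10], verbatim: *"The configuration V^{(j)}_{Z_{j+1}∖Z_j} is defined on Z^{∼−1}_{j+1}∖Z^∼_j by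
V^{(j)}_{Z_{j+1}∖Z_j} = M^j(U(𝔹(Z_{j+1}∖Z_j) ∪ 𝔹_k, M˙(Q^{s*}V))), (1.33) where the determining set was defined in (2.14)
[III]. In fact in the above case it is simply given by 𝔹_{j+1}(Z_{j+1})↾_{Ω_{j+1}} ∪ 𝔹_j(Z^c_j)↾_{Ω^c_{j+1}}, and the
configuration Q^{s*}V is equal to Q^{s*}_{j+1}V_{j+1} on Ω_{j+1} ∩ Z_{j+1}, and to Q^{s*}_jV_j on Ω^c_{j+1} ∩ Z^c_j."* —
typed by the "simply given by" sentence: `Bup` = `𝔹_{j+1}(Z_{j+1})`, `Blow` = `𝔹_j(Z_j^c)` (localized determining sets,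
READING (d)), `Ωj1` = `Ω_{j+1}`, `QsV` = the fine-lattice configuration `Q^{s*}V` of the last sentence. [cite: Balaban1989LargeFieldI, (1.33) p.184] -/
def vSeam133 (Bup Blow : DetSet P) (Ωj1 : Set (Site P 0)) (QsV : GaugeField P 0 G) (j : ℕ) : GaugeField P j G :=
  Averaging.iter av j (bg.U (Bup.restrict Ωj1 ∪ Blow.restrict Ωj1ᶜ) (avgFamily av QsV))

/-- **(1.74)** p. 192 [PDF 18], verbatim: *"Take the function U_{k,Z}(V_k) given by U_{k,Z} = U_{k,Z}(V_k) = U(𝔹_k(Z),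
M˙(Q_k^{s*}V_k)). (1.74) This function is also important for subsequent constructions. It is defined in each component of
Z separately."* (`BkZ` = `𝔹_k(Z)`, `Qs` as in (1.20); the schematic shape used downstream is `…B16ComponentForm.blockForm`). [cite: Balaban1989LargeFieldI, (1.74) p.192] -/
def bgKZ (BkZ : DetSet P) (Qs : GaugeField P k G → GaugeField P 0 G) (Vk : GaugeField P k G) : GaugeField P 0 G :=
  bg.U BkZ (avgFamily av (Qs Vk))

/-- **(1.77)** p. 194 [PDF 20], verbatim: *"Consider the function V_k↾_Λ → A(U_{k,Z}(V_k)). (1.77) It is defined on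
configurations V_k satisfying mild regularity conditions, e.g., |∂V_k − 1| < a₁ on Z. The function is invariant with
respect to the group of all gauge transformations defined on Λ"* — the Wilson action of (1.74) as a function of `V_k`
(the regularity domain is a hypothesis of Proposition 1, `…B15.Prop1Printed`, whose abstract carrier `…B15.LFVar` this
concretises). [cite: Balaban1989LargeFieldI, (1.77) p.194] -/
noncomputable def fun177 (BkZ : DetSet P) (Qs : GaugeField P k G → GaugeField P 0 G) (Vk : GaugeField P k G) : ℝ :=
  wilsonAction4 (bgKZ bg BkZ Qs Vk)

/-- Proposition 1 p. 194, the object it produces: `VΛ` is *"a minimum of the function"* (1.77) over the variables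
`V_k↾_Λ` (the bonds `Λb` of `Λ`), the other variables frozen at the given `V_k↾_{Z∩Λᶜ}` (`Vout`), *"denoted by V_Λ =
V_Λ(V_k↾_{Z∩Λᶜ})"*; p. 195: *"Extend the function V_Λ on the whole domain Z putting V_Λ = V_k on Z ∩ Λᶜ"*.  Existence and
uniqueness of the critical orbit = `…B15.Prop1Printed` (proof in [Balaban1989LargeFieldII] pp. 358–359), NOT asserted. [cite: Balaban1989LargeFieldI, Prop. 1 (1.78) p.194] -/
def IsVLambda (BkZ : DetSet P) (Qs : GaugeField P k G → GaugeField P 0 G) (Λb : Set (PBond P k))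
    (Vout VΛ : GaugeField P k G) : Prop :=
  (∀ b, b ∉ Λb → VΛ b = Vout b) ∧
    ∀ W : GaugeField P k G, (∀ b, b ∉ Λb → W b = Vout b) → fun177 bg BkZ Qs VΛ ≤ fun177 bg BkZ Qs W

/-- **(1.79)** p. 195 [PDF 21], verbatim: *"Extend the function V_Λ on the whole domain Z putting V_Λ = V_k on Z ∩ Λᶜ, and
define U₀ = U_{k,Z}(V_Λ). (1.79) This is a fundamental background field for the constructions of this and the next
sections."* — the composition of (1.74) with the minimizer of Proposition 1 (`IsVLambda`); its printed regularity (1.80)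
is the leaf `…B15.Ineq180`. [cite: Balaban1989LargeFieldI, (1.79) p.195] -/
def bgU0 (BkZ : DetSet P) (Qs : GaugeField P k G → GaugeField P 0 G) (VΛ : GaugeField P k G) : GaugeField P 0 G :=
  bgKZ bg BkZ Qs VΛ

/-- (1.79) with Proposition 1: `A(U₀)` is the minimum value of the function (1.77) over the fields agreeing with `V_k` off
`Λ`, whenever `V_Λ` is its minimizer (definitional bookkeeping). [cite: Balaban1989LargeFieldI, (1.79) p.195] -/
theorem wilsonAction4_bgU0_le {BkZ : DetSet P} {Qs : GaugeField P k G → GaugeField P 0 G} {Λb : Set (PBond P k)}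
    {Vout VΛ : GaugeField P k G} (hV : IsVLambda bg BkZ Qs Λb Vout VΛ) (W : GaugeField P k G)
    (hW : ∀ b, b ∉ Λb → W b = Vout b) : wilsonAction4 (bgU0 bg BkZ Qs VΛ) ≤ fun177 bg BkZ Qs W :=
  hV.2 W hW

end LocalBackgrounds

/-! ## Part G (v1.1). B15 (1.12): the sequence `{Ω″_j}` is NESTED — the first clause of *"The sequence {Ω″_j} is an
admissible sequence"* (p. 179), PROVED from the nesting of `{Ω_j}`, the growth of `Z″_j` in `j` above `h` ((1.10)–(1.11):
`Z″_j = (Ω_j^{∼5})ᶜ ∩ Z`), and the junction inclusion `Z ∖ Z″_{h+1} ⊆ Ω_h` (i.e. `Ω^{∼5}_{h+1} ∩ Z ⊆ Ω_h`, part of the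
admissibility of `{Ω_j}`), all displayed as hypotheses -/

section Nesting

variable {Ω Zpp : ℕ → Set (Site P 0)} {Z : Set (Site P 0)} {h : ℕ}

/-- Above `h`: `Ω″_{j+1} ⊆ Ω″_j` from `Ω_{j+1} ⊆ Ω_j` and `Z″_j ⊆ Z″_{j+1}`. [cite: Balaban1989LargeFieldI, (1.12) p.179] -/
theorem omegaPP_succ_subset_of_lt {j : ℕ} (hj : h < j) (hΩ : Ω (j + 1) ⊆ Ω j) (hZ : Zpp j ⊆ Zpp (j + 1)) :
    omegaPP Ω Zpp Z h (j + 1) ⊆ omegaPP Ω Zpp Z h j := by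
  rw [omegaPP_of_lt hj, omegaPP_of_lt (show h < j + 1 by omega)]
  rintro x (⟨hx1, hx2⟩ | ⟨hx1, hx2⟩)
  · exact Or.inl ⟨fun hx => hx1 (hZ hx), hx2⟩
  · exact Or.inr ⟨hΩ hx1, hx2⟩

/-- At the junction: `Ω″_{h+1} ⊆ Ω″_h = Ω_h` from `Ω_{h+1} ⊆ Ω_h` and `Z ∖ Z″_{h+1} ⊆ Ω_h`.
[cite: Balaban1989LargeFieldI, (1.12) p.179] -/
theorem omegaPP_succ_subset_self (hΩ : Ω (h + 1) ⊆ Ω h) (hjoin : Z \ Zpp (h + 1) ⊆ Ω h) :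
    omegaPP Ω Zpp Z h (h + 1) ⊆ omegaPP Ω Zpp Z h h := by
  rw [omegaPP_of_lt (show h < h + 1 by omega), omegaPP_of_le (le_refl h)]
  rintro x (⟨hx1, hx2⟩ | ⟨hx1, -⟩)
  · exact hjoin ⟨hx2, hx1⟩
  · exact hΩ hx1

/-- Below `h`: `Ω″_{j+1} = Ω_{j+1} ⊆ Ω_j = Ω″_j`. [cite: Balaban1989LargeFieldI, (1.12) p.179] -/
theorem omegaPP_succ_subset_of_succ_le {j : ℕ} (hj : j + 1 ≤ h) (hΩ : Ω (j + 1) ⊆ Ω j) :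
    omegaPP Ω Zpp Z h (j + 1) ⊆ omegaPP Ω Zpp Z h j := by
  rw [omegaPP_of_le hj, omegaPP_of_le (show j ≤ h by omega)]
  exact hΩ

/-- **(1.12), NESTING CLAUSE of «{Ω″_j} is an admissible sequence»**: if `{Ω_j}` is nested, `Z″_j` grows with `j` above
`h`, and `Z ∖ Z″_{h+1} ⊆ Ω_h`, then `Ω″_{j+1} ⊆ Ω″_j` for every `j`. [cite: Balaban1989LargeFieldI, (1.12) p.179] -/
theorem omegaPP_succ_subset (hΩ : ∀ j, Ω (j + 1) ⊆ Ω j) (hZ : ∀ j, h < j → Zpp j ⊆ Zpp (j + 1))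
    (hjoin : Z \ Zpp (h + 1) ⊆ Ω h) (j : ℕ) : omegaPP Ω Zpp Z h (j + 1) ⊆ omegaPP Ω Zpp Z h j := by
  rcases lt_trichotomy h j with hj | rfl | hj
  · exact omegaPP_succ_subset_of_lt hj (hΩ j) (hZ j hj)
  · exact omegaPP_succ_subset_self (hΩ h) hjoin
  · exact omegaPP_succ_subset_of_succ_le (by omega) (hΩ j)

/-- … hence `{Ω″_j}` is antitone in `j`. [cite: Balaban1989LargeFieldI, (1.12) p.179] -/
theorem omegaPP_antitone (hΩ : ∀ j, Ω (j + 1) ⊆ Ω j) (hZ : ∀ j, h < j → Zpp j ⊆ Zpp (j + 1))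
    (hjoin : Z \ Zpp (h + 1) ⊆ Ω h) : Antitone (omegaPP Ω Zpp Z h) :=
  antitone_nat_of_succ_le fun j => omegaPP_succ_subset hΩ hZ hjoin j

end Nesting

end Literature.MathematicalPhysics.QuantumFieldTheory.Balaban1983to89.B15DeterminingSets
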